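import Summits.BirchSwinnertonDyer.BirchSwinnertonDyer.Theorems.AlignedTransportAtTwoBSDOfMainConjectureRankOneAtTwoEulerCharAtTwoKerGLocalOrders
import Summits.BirchSwinnertonDyer.BirchSwinnertonDyer.Theorems.ByReductionTypeAtTwoEulerCharAtTwoAll
import Summits.BirchSwinnertonDyer.BirchSwinnertonDyer.Theorems.ByReductionTypeAtTwoTowerNoFiniteSubmoduleHolds
import HarnessLib

/-!
# Route `AlignedTransportAtTwo`, crux C3′ `BSDOfMainConjectureRankOneAtTwo` (stmt-BirchSwinnertonDyer-23008), line `birth`, the (L) road: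
# Greenberg's Lemma 3.4 at the place over `2` is a TREE THEOREM at layer `0` — the named PRINT fact `h34` of `…KerGLocalOrders` DISCHARGED;
# the open stub at a cell curve ⟺ (H) modulo ONE named fact (Greenberg Prop. 4.14), resp. modulo the generic Cassels–Tate layer pairing

HONEST FRAMING (cell `bsd-f1-sign2`, attach seat `bsd-line-att-p3` g13 under the C3′ lead lineage `bsd-line-att-p1`;
`--supports stmt-BirchSwinnertonDyer-23008 --as helper`). BSD is NOT proved; C3′ is NOT closed; nothing is asserted. THEOREMS ONLY (no `def`,
no named fact, no `sorry`). Successor of `…KerGLocalOrders` (att-p3 g12): there the local order AT the place over `p` entered by NAME as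
Greenberg's Lemma 3.4 (`h34 : Greenberg1999.lemma34_natCard_localTowerKerPrimary_eq_rat`, every `p`, every layer). The C3′ cell uses it only at
`(p, n) = (2, 0)`, and THAT instance is a kernel theorem of cell `bsd-2adic` (seat `bsd-2adic-tower-1` GEN 25,
`Theorems/ByReductionTypeAtTwoEulerCharAtTwoAll.lean`): `GoodOrdTower.natCard_localTowerKerPrimary_zero_eq_sq_two` —
`#𝒦_{v,0}[2^∞] = (2^{ord₂ #Ẽ(𝔽₂)})²` for `W/ℚ` globally minimal elliptic with `GoodOrd W 2` (≡ `IsOrdinaryAt W 2`), `κ` cyclotomic, `v ∋ 2`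
(lower bound `2^e ≤ #H²(Γ_{ℚ_v}, Ê[2^e]) ≤ #(M₁/(g−1)M₁)[2^∞]`, upper bound `…EulerCharFormalBound`). This file plugs it in.

* §1 `lemma34_natCard_localTowerKerPrimary_eq_rat_two_zero` — **Lemma 3.4 at `(p, n) = (2, 0)` in the named fact's own currency**:
  `Finite 𝒦_{v,0}[2^∞] ∧ #𝒦_{v,0}[2^∞] = (2^{ord₂ #Ẽ(𝔽₂)})²` (`IsOrdinaryAt W 2`, `κ` cyclotomic, `v ∋ 2`).
* §2 `prod_natCard_localTowerKerPrimary_eq_localOrders_two` — **the cell's local orders, UNCONDITIONAL**: for `W/ℚ` globally minimal with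
  `IsOrdinaryAt W 2`, the cyclotomic `κ` and every finite `S ⊇ {2} ∪ {bad}`,
  **`∏_{v∈S} #𝒦_{v,0}[2^∞] = 2^{v₂(∏ c_v)} · #Ẽ(𝔽₂)(2)²`** (= `h34` discharged in `…KerGLocalOrders.prod_natCard_localTowerKerPrimary_eq_localOrders_of_lemma34`;
  the places `v ∤ 2` are the tree's Lemma 3.3 VALUE, `…KerGLocalOrders` §1–§2).
* §3 `schneiderLeadingTermFormulaAtTwoSqAt_iff_heightIndexAt_of_prop414` — **THE OPEN STUB OF C3′ AT A CELL CURVE ⟺ THE HEIGHT-INDEX IDENTITY (H),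
  modulo ONE named PRINT fact** (Greenberg Prop. 4.14 / Hachimori–Matsuno Cor. (i), `h414`) instead of two; `…_of_not_dvd_torsionOrder` the same with
  the binder `E(ℚ)[2] = 0` derived from `2 ∤ #E(ℚ)_tors`; §4 `…_of_casselsTateLayerPairing` — the same modulo the GENERIC Cassels–Tate layer pairing
  (`HachimoriMatsuno2000.casselsTate_layerPairing`, from which the tree derives Prop. 4.14 over `ℚ`: `TowerHaMa.prop414_of_casselsTateLayerPairing`).

READING (for the lead / the planner): per cell curve the residual of `stub_leadingTermFormulaAtTwo` is (H) ALONE modulo Prop. 4.14 (equivalently: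
modulo the Cassels–Tate pairing on the layers `Sel_{2^∞}(E/ℚ_n)`); NO local PRINT input at `2` remains — Lemma 3.3 (value) and Lemma 3.4 (layer `0`)
are both kernel theorems at `p = 2`. A v9 re-pointing of the skeleton {M, GZK, Σ² closed, Disegni, P414 PRINT; H OPEN} is the lead's call.

References: [GreenbergLNM1716] §3 Lemmas 3.3–3.4 (pp. 86–89), §4 Lemma 4.7, Prop. 4.14; [CoatesGreenberg1996] Cor. 3.2; [HachimoriMatsuno2000] Thm., Cor. (i)
(p. 2540); [Cassels1962ArithmeticIV]; [SilvermanAEC2009] X.4.14, VII.6; [PerrinRiou1992] §3.4; [Schneider1985] §§6–8.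
bears_on: stmt-BirchSwinnertonDyer-23008 (helper; closes nothing), stmt-BirchSwinnertonDyer-22298 (attach seat's item; untouched).
-/

set_option autoImplicit false
-- the Theorems namespace of this sub repeats the summit name by design (D-0017 nested layout)
set_option linter.dupNamespace false

noncomputable section

open scoped Classical NumberField

open Field NumberField IsDedekindDomain Function WeierstrassCurve
open Literature.NumberTheory.EllipticCurves Literature.NumberTheory.EllipticCurves.GreenbergSelmer
open Literature.NumberTheory.GaloisRepresentations
open Literature.NumberTheory.GaloisCohomology
open scoped ContRepresentation

namespace Summit.BirchSwinnertonDyer.BirchSwinnertonDyer.Theorems.AlignedTransportAtTwoEulerCharAtTwoKerGLemma34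

open Summit.BirchSwinnertonDyer.BirchSwinnertonDyer.Theorems.AlignedTransportAtTwoEulerCharAtTwoKerGCell
open Summit.BirchSwinnertonDyer.BirchSwinnertonDyer.Theorems.AlignedTransportAtTwoEulerCharAtTwoKerGLocalOrders
open ZpExtension Literature.NumberTheory.EllipticCurves.IwasawaAlgebra Literature.NumberTheory.EllipticCurves.IwasawaDual
open Literature.NumberTheory.EllipticCurves.Greenberg1999 Rat.HeightOneSpectrum

variable (W : WeierstrassCurve ℚ) [W.IsElliptic] [W.IsGloballyMinimal]

/-! ## §1 Greenberg's Lemma 3.4 at `(p, n) = (2, 0)`, in the named fact's currency -/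

/-- **Greenberg's Lemma 3.4 at the prime `2`, layer `0`, as a THEOREM** (the `(p, n) = (2, 0)` instance of the named fact
`Greenberg1999.lemma34_natCard_localTowerKerPrimary_eq_rat`): for `W/ℚ` globally minimal elliptic with `IsOrdinaryAt W 2` (good ordinary),
`κ` the cyclotomic `ℤ₂`-extension and `v ∋ 2`, the `2`-power torsion of the local tower kernel `𝒦_{v,0}` is finite of order
`(2^{ord₂ #Ẽ(𝔽₂)})²` (`= 4` if `a₂ = 1`, `= 16` if `a₂ = −1`). The count is cell `bsd-2adic`'s `GoodOrdTower.natCard_localTowerKerPrimary_zero_eq_sq_two`.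
[cite: GreenbergLNM1716, §3 Lemma 3.4 (p. 89)] [cite: CoatesGreenberg1996, Cor. 3.2] -/
theorem lemma34_natCard_localTowerKerPrimary_eq_rat_two_zero (hord : IsOrdinaryAt W 2) (κ : ZpExtension ℚ 2) (hκ : κ.IsCyclotomic)
    (v : HeightOneSpectrum (𝓞 ℚ)) (hpv : ((2 : ℕ) : 𝓞 ℚ) ∈ v.asIdeal) :
    Finite (W.localTowerKerPrimary κ (v.adicCompletion ℚ) 0) ∧
      Nat.card (W.localTowerKerPrimary κ (v.adicCompletion ℚ) 0) = (2 ^ padicValNat 2 (W.reductionPointCount 2)) ^ 2 :=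
  ⟨finite_localTowerKerPrimary_zero_of_isOrdinaryAt W 2 hord κ hκ v,
    GoodOrdTower.natCard_localTowerKerPrimary_zero_eq_sq_two hκ v hpv W hord⟩

/-- **Lemma 3.4 at `(2, 0)`, `p`-primary-component form**: `#𝒦_{v,0}[2^∞] = #Ẽ(𝔽₂)(2)²` with `Ẽ` the reduction of the minimal model at `2`.
[cite: GreenbergLNM1716, §3 Lemma 3.4 (p. 89)] -/
theorem natCard_localTowerKerPrimary_zero_eq_sq_natCard_primaryComponent_two (hord : IsOrdinaryAt W 2) (κ : ZpExtension ℚ 2)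
    (hκ : κ.IsCyclotomic) (v : HeightOneSpectrum (𝓞 ℚ)) (hpv : ((2 : ℕ) : 𝓞 ℚ) ∈ v.asIdeal) :
    Nat.card (W.localTowerKerPrimary κ (v.adicCompletion ℚ) 0) =
      Nat.card (AddCommGroup.primaryComponent ((integralModelInt W).map (Int.castRingHom (ZMod 2))).toAffine.Point 2) ^ 2 := by
  rw [GoodOrdTower.natCard_localTowerKerPrimary_zero_eq_sq_two hκ v hpv W hord, natCard_primaryComponent_eq_pow_padicValNat 2]
  rfl

/-! ## §2 The cell's local orders at `2`, unconditional -/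

/-- **THE LOCAL ORDERS ON THE CELL, UNCONDITIONAL**: for `W/ℚ` globally minimal with `IsOrdinaryAt W 2`, the cyclotomic `κ` and `S ⊇ {2} ∪ {bad}`,
**`∏_{v∈S} #𝒦_{v,0}[2^∞] = 2^{v₂(∏ c_v)} · #Ẽ(𝔽₂)(2)²`** — the `v ∤ 2` factors are the tree's Lemma 3.3 VALUE (`…KerGLocalOrders` §1–§2), the
factor at `2` is §1. This is the hypothesis `hloc` of `…KerGCell.schneiderLeadingTermFormulaAtTwoSqAt_iff_heightIndexAt_of_prop414_of_localOrders`
and `…KerGLocalOrders.prod_natCard_localTowerKerPrimary_eq_localOrders_of_lemma34` with `h34` discharged.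
[cite: GreenbergLNM1716, §3 Lemmas 3.3–3.4 (pp. 86–89), §4 Thm. 4.1 (p. 102)] -/
theorem prod_natCard_localTowerKerPrimary_eq_localOrders_two (hord : IsOrdinaryAt W 2) (κ : ZpExtension ℚ 2) (hκ : κ.IsCyclotomic)
    (S : Finset (HeightOneSpectrum (𝓞 ℚ))) (hS : ∀ v ∉ S, ((2 : ℕ) : 𝓞 ℚ) ∉ v.asIdeal ∧ W.HasGoodReductionAt v) :
    ∏ v ∈ S, Nat.card (W.localTowerKerPrimary κ (v.adicCompletion ℚ) 0) =
      2 ^ padicValNat 2 W.tamagawaProduct *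
        Nat.card (AddCommGroup.primaryComponent ((integralModelInt W).map (Int.castRingHom (ZMod 2))).toAffine.Point 2) ^ 2 := by
  have hv₀ := AlignedTransportAtTwoEulerCharAtTwoKerGLocalOrders.natCast_mem_asIdeal_primesEquiv_symm 2
  rw [prod_natCard_localTowerKerPrimary_eq_mul_pow_rat W 2 hord.1 κ hκ S hS hv₀,
    natCard_localTowerKerPrimary_zero_eq_sq_natCard_primaryComponent_two W hord κ hκ _ hv₀, mul_comm]

/-! ## §3 The open stub of C3′ at a cell curve ⟺ (H), modulo the ONE named PRINT fact Prop. 4.14 -/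

/-- **THE OPEN STUB OF C3′ AT A CELL CURVE ⟺ THE HEIGHT-INDEX IDENTITY (H), MODULO ONE NAMED PRINT FACT**: Greenberg Prop. 4.14 / Hachimori–Matsuno
Cor. (i) (`h414 : prop414_noFiniteSubmodule_of_not_dvd_torsionOrder`). For `W/ℚ` globally minimal, `IsOrdinaryAt W 2`, `E(ℚ)[2] = 0`,
`2 ∤ #E(ℚ)_tors`, `S ⊇ {2} ∪ {bad}`: `SchneiderLeadingTermFormulaAtTwoSqAt W` holds IFF for every cyclotomic datum, every finitely generated torsion
strict dual `D`, THE `Σ²` height `Dh` with `Reg₂(Dh) ≠ 0`, `Ш(E/ℚ)(2)` finite, and every `e`, `e₀`, `κ_M : M ↪ Sel_{2^∞}(E/ℚ)` (cokernel of order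
`#Ш(2)`), the derived Kummer map `θ` has finite kernel, TRIVIAL cokernel, and **`#ker θ · (log₂5)^{rank E(ℚ)} = u · Reg₂(Dh) · i_S`**, `u ∈ ℤ₂ˣ`,
`i_S = (∏_{v∈S} #𝒦_{v,0}[2^∞]) / #(A₀/Sel₀) = [E(ℚ) : E_𝒦]` the Cassels–Poitou–Tate index (`…KerGCell.exists_level_kerIndexL_rat`). This is
`…KerGLocalOrders.schneiderLeadingTermFormulaAtTwoSqAt_iff_heightIndexAt_of_prop414_of_lemma34` with `h34` DISCHARGED (§2): no local PRINT input at
`2` remains. READING: what is open of C3′ at a cell curve is (H) alone — «the Bockstein pairing of `θ` is the canonical `Σ²` height up to a `2`-adic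
unit, with universal-norm index `[E(ℚ):E_𝒦]`» (Perrin-Riou 1992 §3.4 / Schneider 1985 for odd `p`; not in print at `2`). Closes nothing.
[cite: GreenbergLNM1716, §3 Lemmas 3.3–3.4, §4 Lemmas 4.2–4.7, Prop. 4.14] [cite: HachimoriMatsuno2000, Cor. (i)] [cite: PerrinRiou1992, §3.4] -/
theorem schneiderLeadingTermFormulaAtTwoSqAt_iff_heightIndexAt_of_prop414
    (h414 : prop414_noFiniteSubmodule_of_not_dvd_torsionOrder)
    (hK : ∀ P : W.toAffine.Point, 2 • P = 0 → P = 0) (h2 : ¬ 2 ∣ W.torsionOrder) (hord : IsOrdinaryAt W 2)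
    (S : Finset (HeightOneSpectrum (𝓞 ℚ))) (hS : ∀ v ∉ S, ((2 : ℕ) : 𝓞 ℚ) ∉ v.asIdeal ∧ W.HasGoodReductionAt v) :
    Summit.BirchSwinnertonDyer.Rank1Residual.F1Sign2.SchneiderLeadingTermFormulaAtTwoSqAt W ↔
    (∀ (κ : ZpExtension ℚ 2) (γ : Field.absoluteGaloisGroup ℚ),
        κ.IsCyclotomic → κ.IsTopGenerator γ → IsCyclotomicVariable 2 γ →
      ∀ (D : W.SelmerDualData κ γ) [Module.Finite (IwasawaAlgebra 2) D.X], D.IsTorsion →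
      ∀ (Dh : PAdicHeightData W 2), Dh.IsCanonicalSq →
        SchneiderConjecture Dh → Finite (AddCommGroup.primaryComponent W.sha 2) →
      ∀ (e : ↥(W.selmerInfty κ ⊓ W.layerInvariants κ 0) ≃+ ↥(endInvariants (W.conjSelmerInfty κ γ - 1)))
        (e₀ : ↥(W.selmerGroupPInfty 2) ≃+ ↥(W.selmerLayer κ 0))
        (M : Type) [AddCommGroup M] (kS : M →+ ↥(W.selmerGroupPInfty 2)), Function.Injective kS →
        Nat.card (↥(W.selmerGroupPInfty 2) ⧸ kS.range) = Nat.card (AddCommGroup.primaryComponent W.sha 2) →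
      ∀ (θ : M →+ EndCoinvariants (W.conjSelmerInfty κ γ - 1)),
        θ = (W.selmerInftyEulerMap κ γ).comp
          (((e : ↥(W.selmerInfty κ ⊓ W.layerInvariants κ 0) →+ ↥(endInvariants (W.conjSelmerInfty κ γ - 1))).comp (W.sMap κ 0)).comp
            ((e₀ : ↥(W.selmerGroupPInfty 2) →+ ↥(W.selmerLayer κ 0)).comp kS)) →
        Finite θ.ker ∧ Nat.card (EndCoinvariants (W.conjSelmerInfty κ γ - 1) ⧸ θ.range) = 1 ∧
        ∃ u : ℤ_[2]ˣ,
          (Nat.card θ.ker : ℚ_[2]) * padicLog 2 (cyclotomicGenerator 2) ^ W.mordellWeilRank =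
            ((u : ℤ_[2]) : ℚ_[2]) * padicRegulator Dh *
              (((∏ v ∈ S, Nat.card (W.localTowerKerPrimary κ (v.adicCompletion ℚ) 0)) / Nat.card (W.KerG κ 0) : ℕ) : ℚ_[2])) :=
  schneiderLeadingTermFormulaAtTwoSqAt_iff_heightIndexAt_of_prop414_of_localOrders W h414 hK h2 hord S hS
    (fun κ hκ ↦ prod_natCard_localTowerKerPrimary_eq_localOrders_two W hord κ hκ S hS)

/-- **The same, with the binder `E(ℚ)[2] = 0` DERIVED from `2 ∤ #E(ℚ)_tors`** (Cauchy in `E(ℚ)_tors`;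
`Rank1Residual.Iwasawa.forall_smul_eq_zero_imp_of_not_dvd_torsionOrder`): the cell's two torsion binders are one.
[cite: GreenbergLNM1716, Prop. 4.14] [cite: HachimoriMatsuno2000, Cor. (i)] -/
theorem schneiderLeadingTermFormulaAtTwoSqAt_iff_heightIndexAt_of_prop414_of_not_dvd_torsionOrder
    (h414 : prop414_noFiniteSubmodule_of_not_dvd_torsionOrder) (h2 : ¬ 2 ∣ W.torsionOrder) (hord : IsOrdinaryAt W 2)
    (S : Finset (HeightOneSpectrum (𝓞 ℚ))) (hS : ∀ v ∉ S, ((2 : ℕ) : 𝓞 ℚ) ∉ v.asIdeal ∧ W.HasGoodReductionAt v) :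
    Summit.BirchSwinnertonDyer.Rank1Residual.F1Sign2.SchneiderLeadingTermFormulaAtTwoSqAt W ↔
    (∀ (κ : ZpExtension ℚ 2) (γ : Field.absoluteGaloisGroup ℚ),
        κ.IsCyclotomic → κ.IsTopGenerator γ → IsCyclotomicVariable 2 γ →
      ∀ (D : W.SelmerDualData κ γ) [Module.Finite (IwasawaAlgebra 2) D.X], D.IsTorsion →
      ∀ (Dh : PAdicHeightData W 2), Dh.IsCanonicalSq →
        SchneiderConjecture Dh → Finite (AddCommGroup.primaryComponent W.sha 2) →
      ∀ (e : ↥(W.selmerInfty κ ⊓ W.layerInvariants κ 0) ≃+ ↥(endInvariants (W.conjSelmerInfty κ γ - 1)))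
        (e₀ : ↥(W.selmerGroupPInfty 2) ≃+ ↥(W.selmerLayer κ 0))
        (M : Type) [AddCommGroup M] (kS : M →+ ↥(W.selmerGroupPInfty 2)), Function.Injective kS →
        Nat.card (↥(W.selmerGroupPInfty 2) ⧸ kS.range) = Nat.card (AddCommGroup.primaryComponent W.sha 2) →
      ∀ (θ : M →+ EndCoinvariants (W.conjSelmerInfty κ γ - 1)),
        θ = (W.selmerInftyEulerMap κ γ).comp
          (((e : ↥(W.selmerInfty κ ⊓ W.layerInvariants κ 0) →+ ↥(endInvariants (W.conjSelmerInfty κ γ - 1))).comp (W.sMap κ 0)).comp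
            ((e₀ : ↥(W.selmerGroupPInfty 2) →+ ↥(W.selmerLayer κ 0)).comp kS)) →
        Finite θ.ker ∧ Nat.card (EndCoinvariants (W.conjSelmerInfty κ γ - 1) ⧸ θ.range) = 1 ∧
        ∃ u : ℤ_[2]ˣ,
          (Nat.card θ.ker : ℚ_[2]) * padicLog 2 (cyclotomicGenerator 2) ^ W.mordellWeilRank =
            ((u : ℤ_[2]) : ℚ_[2]) * padicRegulator Dh *
              (((∏ v ∈ S, Nat.card (W.localTowerKerPrimary κ (v.adicCompletion ℚ) 0)) / Nat.card (W.KerG κ 0) : ℕ) : ℚ_[2])) :=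
  schneiderLeadingTermFormulaAtTwoSqAt_iff_heightIndexAt_of_prop414 W h414
    (fun P hP ↦ Summit.BirchSwinnertonDyer.Rank1Residual.Iwasawa.forall_smul_eq_zero_imp_of_not_dvd_torsionOrder W h2 P
      (by convert hP))
    h2 hord S hS

/-! ## §4 The same modulo the generic Cassels–Tate layer pairing -/

/-- **THE OPEN STUB OF C3′ AT A CELL CURVE ⟺ (H), MODULO THE GENERIC CASSELS–TATE LAYER PAIRING** (`HachimoriMatsuno2000.casselsTate_layerPairing`:
on every layer `Sel_{p^∞}(E/K_n)` of a `ℤ_p`-extension an alternating, Galois-equivariant pairing with kernel the divisible elements, restriction adjoint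
to corestriction — Cassels 1962 / Silverman X.4.14 / Milne I 6.13). Greenberg's Prop. 4.14 over `ℚ` follows from it by the tree's kernel theorem
`TowerHaMa.prop414_of_casselsTateLayerPairing` (Hachimori–Matsuno's proof), so §3 holds with `h414` replaced by `hCT`.
[cite: HachimoriMatsuno2000, Theorem and Cor. (i), proof p. 2540 L28–L45] [cite: SilvermanAEC2009, Thm. X.4.14] [cite: GreenbergLNM1716, Prop. 4.14] -/
theorem schneiderLeadingTermFormulaAtTwoSqAt_iff_heightIndexAt_of_casselsTateLayerPairing
    (hCT : HachimoriMatsuno2000.casselsTate_layerPairing.{0})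
    (hK : ∀ P : W.toAffine.Point, 2 • P = 0 → P = 0) (h2 : ¬ 2 ∣ W.torsionOrder) (hord : IsOrdinaryAt W 2)
    (S : Finset (HeightOneSpectrum (𝓞 ℚ))) (hS : ∀ v ∉ S, ((2 : ℕ) : 𝓞 ℚ) ∉ v.asIdeal ∧ W.HasGoodReductionAt v) :
    Summit.BirchSwinnertonDyer.Rank1Residual.F1Sign2.SchneiderLeadingTermFormulaAtTwoSqAt W ↔
    (∀ (κ : ZpExtension ℚ 2) (γ : Field.absoluteGaloisGroup ℚ),
        κ.IsCyclotomic → κ.IsTopGenerator γ → IsCyclotomicVariable 2 γ →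
      ∀ (D : W.SelmerDualData κ γ) [Module.Finite (IwasawaAlgebra 2) D.X], D.IsTorsion →
      ∀ (Dh : PAdicHeightData W 2), Dh.IsCanonicalSq →
        SchneiderConjecture Dh → Finite (AddCommGroup.primaryComponent W.sha 2) →
      ∀ (e : ↥(W.selmerInfty κ ⊓ W.layerInvariants κ 0) ≃+ ↥(endInvariants (W.conjSelmerInfty κ γ - 1)))
        (e₀ : ↥(W.selmerGroupPInfty 2) ≃+ ↥(W.selmerLayer κ 0))
        (M : Type) [AddCommGroup M] (kS : M →+ ↥(W.selmerGroupPInfty 2)), Function.Injective kS →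
        Nat.card (↥(W.selmerGroupPInfty 2) ⧸ kS.range) = Nat.card (AddCommGroup.primaryComponent W.sha 2) →
      ∀ (θ : M →+ EndCoinvariants (W.conjSelmerInfty κ γ - 1)),
        θ = (W.selmerInftyEulerMap κ γ).comp
          (((e : ↥(W.selmerInfty κ ⊓ W.layerInvariants κ 0) →+ ↥(endInvariants (W.conjSelmerInfty κ γ - 1))).comp (W.sMap κ 0)).comp
            ((e₀ : ↥(W.selmerGroupPInfty 2) →+ ↥(W.selmerLayer κ 0)).comp kS)) →
        Finite θ.ker ∧ Nat.card (EndCoinvariants (W.conjSelmerInfty κ γ - 1) ⧸ θ.range) = 1 ∧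
        ∃ u : ℤ_[2]ˣ,
          (Nat.card θ.ker : ℚ_[2]) * padicLog 2 (cyclotomicGenerator 2) ^ W.mordellWeilRank =
            ((u : ℤ_[2]) : ℚ_[2]) * padicRegulator Dh *
              (((∏ v ∈ S, Nat.card (W.localTowerKerPrimary κ (v.adicCompletion ℚ) 0)) / Nat.card (W.KerG κ 0) : ℕ) : ℚ_[2])) :=
  schneiderLeadingTermFormulaAtTwoSqAt_iff_heightIndexAt_of_prop414 W
    (Summit.BirchSwinnertonDyer.BirchSwinnertonDyer.Theorems.TowerHaMa.prop414_of_casselsTateLayerPairing hCT) hK h2 hord S hS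

/-! ## §5 NO named fact at all: the open stub of C3′ at a cell curve ⟺ the height-index RATIO identity (H′) -/

set_option maxHeartbeats 2000000 in -- instance-path unifications on the local cohomology groups (as in `…KerGCell`)
/-- **THE OPEN STUB OF C3′ AT A CELL CURVE ⟺ THE HEIGHT-INDEX RATIO IDENTITY (H′) — UNCONDITIONALLY (no named fact, no PRINT input).**
For `W/ℚ` globally minimal, `IsOrdinaryAt W 2`, `E(ℚ)[2] = 0`, `S ⊇ {2} ∪ {bad}`: `SchneiderLeadingTermFormulaAtTwoSqAt W` holds IFF for every
cyclotomic datum, every finitely generated torsion strict dual `D`, THE `Σ²` height `Dh` with `Reg₂(Dh) ≠ 0`, `Ш(E/ℚ)(2)` finite, and every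
`e`, `e₀`, `κ_M : M ↪ Sel_{2^∞}(E/ℚ)` (cokernel of order `#Ш(2)`), the derived Kummer map `θ` has finite kernel AND finite cokernel and
**`#ker θ · (log₂5)^{rank E(ℚ)} = u · #coker θ · Reg₂(Dh) · i_S`**, `u ∈ ℤ₂ˣ`, `i_S = (∏_{v∈S} #𝒦_{v,0}[2^∞]) / #(A₀/Sel₀)` the
Cassels–Poitou–Tate index. Ingredients: att-p4 g7's `Ш`-free form `…AssemblyKummer.schneiderLeadingTermFormulaAtTwoSqAt_iff_shaFreeAt`
(`#ker θ · #(A₀/Sel₀) · (log₂5)^r = u · #coker θ · Reg₂ · 2^{v₂(∏c_v)} · #Ẽ(𝔽₂)(2)²`, no named fact) and the cell's local orders §2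
(`∏_{v∈S} #𝒦_{v,0}[2^∞] = 2^{v₂(∏c_v)} · #Ẽ(𝔽₂)(2)²`, now a theorem), divided by `#(A₀/Sel₀) ≠ 0`. Compared with §3: Greenberg's Prop. 4.14
(the only named fact there) served only to make `#coker θ = 1`; WITHOUT it the cokernel order stays in the identity, and NOTHING printed is
assumed. READING: per cell curve, modulo NO local or `Λ`-module input, the residual of `stub_leadingTermFormulaAtTwo` is (H′): «the Bockstein
pairing of `θ` is the canonical `Σ²` height up to a `2`-adic unit: `#ker θ/#coker θ = Reg₂(Dh) · [E(ℚ):E_𝒦] / (log₂5)^r`» (Perrin-Riou 1992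
§3.4 / Schneider 1985 §§6–8 for odd `p`; not in print at `2`). Closes nothing.
[cite: GreenbergLNM1716, §3 Lemmas 3.3–3.4, §4 Lemmas 4.2–4.7] [cite: PerrinRiou1992, §3.4] [cite: CoatesSchneiderSujatha2003, p. 204] -/
theorem schneiderLeadingTermFormulaAtTwoSqAt_iff_heightIndexRatioAt
    (hK : ∀ P : W.toAffine.Point, 2 • P = 0 → P = 0) (hord : IsOrdinaryAt W 2)
    (S : Finset (HeightOneSpectrum (𝓞 ℚ))) (hS : ∀ v ∉ S, ((2 : ℕ) : 𝓞 ℚ) ∉ v.asIdeal ∧ W.HasGoodReductionAt v) :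
    Summit.BirchSwinnertonDyer.Rank1Residual.F1Sign2.SchneiderLeadingTermFormulaAtTwoSqAt W ↔
    (∀ (κ : ZpExtension ℚ 2) (γ : Field.absoluteGaloisGroup ℚ),
        κ.IsCyclotomic → κ.IsTopGenerator γ → IsCyclotomicVariable 2 γ →
      ∀ (D : W.SelmerDualData κ γ) [Module.Finite (IwasawaAlgebra 2) D.X], D.IsTorsion →
      ∀ (Dh : PAdicHeightData W 2), Dh.IsCanonicalSq →
        SchneiderConjecture Dh → Finite (AddCommGroup.primaryComponent W.sha 2) →
      ∀ (e : ↥(W.selmerInfty κ ⊓ W.layerInvariants κ 0) ≃+ ↥(endInvariants (W.conjSelmerInfty κ γ - 1)))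
        (e₀ : ↥(W.selmerGroupPInfty 2) ≃+ ↥(W.selmerLayer κ 0))
        (M : Type) [AddCommGroup M] (kS : M →+ ↥(W.selmerGroupPInfty 2)), Function.Injective kS →
        Nat.card (↥(W.selmerGroupPInfty 2) ⧸ kS.range) = Nat.card (AddCommGroup.primaryComponent W.sha 2) →
      ∀ (θ : M →+ EndCoinvariants (W.conjSelmerInfty κ γ - 1)),
        θ = (W.selmerInftyEulerMap κ γ).comp
          (((e : ↥(W.selmerInfty κ ⊓ W.layerInvariants κ 0) →+ ↥(endInvariants (W.conjSelmerInfty κ γ - 1))).comp (W.sMap κ 0)).comp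
            ((e₀ : ↥(W.selmerGroupPInfty 2) →+ ↥(W.selmerLayer κ 0)).comp kS)) →
        Finite θ.ker ∧ Finite (EndCoinvariants (W.conjSelmerInfty κ γ - 1) ⧸ θ.range) ∧
        ∃ u : ℤ_[2]ˣ,
          (Nat.card θ.ker : ℚ_[2]) * padicLog 2 (cyclotomicGenerator 2) ^ W.mordellWeilRank =
            ((u : ℤ_[2]) : ℚ_[2]) * Nat.card (EndCoinvariants (W.conjSelmerInfty κ γ - 1) ⧸ θ.range) * padicRegulator Dh *
              (((∏ v ∈ S, Nat.card (W.localTowerKerPrimary κ (v.adicCompletion ℚ) 0)) / Nat.card (W.KerG κ 0) : ℕ) : ℚ_[2])) := by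
  refine (AlignedTransportAtTwoEulerCharAtTwoAssemblyKummer.schneiderLeadingTermFormulaAtTwoSqAt_iff_shaFreeAt W hK hord).trans
    ⟨?_, ?_⟩
  · intro h κ γ hκ hγ hγ' D _ hX Dh hDh hS' hSha e e₀ M _ kS hkS hkS' θ hθ
    obtain ⟨hk, hc, u, hu⟩ := h κ γ hκ hγ hγ' D hX Dh hDh hS' hSha e e₀ M kS hkS hkS' θ hθ
    refine ⟨hk, hc, u, ?_⟩
    haveI : Finite (W.KerG κ 0) := AlignedTransportAtTwoEulerCharAtTwoAssemblyKummer.finite_kerG_zero_of_isOrdinaryAt W hord κ hκ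
    have ha : (Nat.card (W.KerG κ 0) : ℚ_[2]) ≠ 0 := by exact_mod_cast Nat.card_pos.ne'
    have hdvd := AlignedTransportAtTwoEulerCharAtTwoKerGEmbedding.natCard_kerG_zero_dvd_prod_rat 2 W κ S hS
    have hP : ((2 : ℚ_[2]) ^ padicValNat 2 W.tamagawaProduct *
        (Nat.card (AddCommGroup.primaryComponent
          ((integralModelInt W).map (Int.castRingHom (ZMod 2))).toAffine.Point 2) : ℚ_[2]) ^ 2) =
        (Nat.card (W.KerG κ 0) : ℚ_[2]) *
          (((∏ v ∈ S, Nat.card (W.localTowerKerPrimary κ (v.adicCompletion ℚ) 0)) / Nat.card (W.KerG κ 0) : ℕ) : ℚ_[2]) := by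
      rw [← Nat.cast_mul, Nat.mul_div_cancel' hdvd, prod_natCard_localTowerKerPrimary_eq_localOrders_two W hord κ hκ S hS]
      push_cast
      ring
    have hu' : (Nat.card θ.ker : ℚ_[2]) * Nat.card (W.KerG κ 0) * padicLog 2 (cyclotomicGenerator 2) ^ W.mordellWeilRank =
        ((u : ℤ_[2]) : ℚ_[2]) * Nat.card (EndCoinvariants (W.conjSelmerInfty κ γ - 1) ⧸ θ.range) * padicRegulator Dh *
          ((2 : ℚ_[2]) ^ padicValNat 2 W.tamagawaProduct *
            (Nat.card (AddCommGroup.primaryComponent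
              ((integralModelInt W).map (Int.castRingHom (ZMod 2))).toAffine.Point 2) : ℚ_[2]) ^ 2) := by
      rw [hu]; ring
    exact (mul_cancel_bookkeeping ha hP).mp hu'
  · intro h κ γ hκ hγ hγ' D _ hX Dh hDh hS' hSha e e₀ M _ kS hkS hkS' θ hθ
    obtain ⟨hk, hc, u, hu⟩ := h κ γ hκ hγ hγ' D hX Dh hDh hS' hSha e e₀ M kS hkS hkS' θ hθ
    refine ⟨hk, hc, u, ?_⟩
    haveI : Finite (W.KerG κ 0) := AlignedTransportAtTwoEulerCharAtTwoAssemblyKummer.finite_kerG_zero_of_isOrdinaryAt W hord κ hκ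
    have ha : (Nat.card (W.KerG κ 0) : ℚ_[2]) ≠ 0 := by exact_mod_cast Nat.card_pos.ne'
    have hdvd := AlignedTransportAtTwoEulerCharAtTwoKerGEmbedding.natCard_kerG_zero_dvd_prod_rat 2 W κ S hS
    have hP : ((2 : ℚ_[2]) ^ padicValNat 2 W.tamagawaProduct *
        (Nat.card (AddCommGroup.primaryComponent
          ((integralModelInt W).map (Int.castRingHom (ZMod 2))).toAffine.Point 2) : ℚ_[2]) ^ 2) =
        (Nat.card (W.KerG κ 0) : ℚ_[2]) *
          (((∏ v ∈ S, Nat.card (W.localTowerKerPrimary κ (v.adicCompletion ℚ) 0)) / Nat.card (W.KerG κ 0) : ℕ) : ℚ_[2]) := by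
      rw [← Nat.cast_mul, Nat.mul_div_cancel' hdvd, prod_natCard_localTowerKerPrimary_eq_localOrders_two W hord κ hκ S hS]
      push_cast
      ring
    have key := (mul_cancel_bookkeeping (x := (Nat.card θ.ker : ℚ_[2]))
      (L := padicLog 2 (cyclotomicGenerator 2) ^ W.mordellWeilRank)
      (c := ((u : ℤ_[2]) : ℚ_[2]) * Nat.card (EndCoinvariants (W.conjSelmerInfty κ γ - 1) ⧸ θ.range) * padicRegulator Dh)
      ha hP).mpr hu
    rw [key]
    ring

end Summit.BirchSwinnertonDyer.BirchSwinnertonDyer.Theorems.AlignedTransportAtTwoEulerCharAtTwoKerGLemma34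

end
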